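import Summits.PneNP.PneNP.Theorems.NegLimitedHalfWindowDefs
import Summits.PneNP.PneNP.Theorems.NegLimitedAmplifiedWindowMonotoneAmplification
import Mathlib
import HarnessLib

/-!
# Route NegLimited — line `half-window`, stub `stub_monotoneAmplificationGen` (rung F-N1/p3, ROUND-13)

Registered stub (A-gen) of the skeleton `half-window` on the rung item `NegLimited.NeglimitedHalfLogNegationsR`
(stmt-PneNP-19888; HOME/pnp-ideate-p3/r13/half-window.lean; card r13/half-window.md; BLUEPRINT-R2.md §A-gen):

  `MonotoneAmplificationGen`: Impagliazzo hard-core + O'Donnell hybrid, MONOTONE version, for an ABSTRACT monotone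
  combiner `Φ` on a finite block set `W` — constant-error hardness of a balanced monotone `f` for size-`s`
  `{∧,∨,0,1}`-circuits under a probability weight `D` amplifies to agreement
  `≤ ½ + expAbsBiasGen Φ (β/2)/2 + |W|⁻¹` for `Φ ∘ f^W` under `D^{⊗W}` against `{∧,∨,0,1}`-circuits `M` with
  `(|M|+1)·K·|W|^8 ≤ s` (`K = 5184/β⁴ + 1`).

This is the door's stub A (`stub_monotoneAmplification`, p485087, for `Φ = RM3_d`, `W = Fin d → Fin 3`) with the
block set and the combiner abstracted; the landed parts A1 (`Amp.hardCoreMonotone_holds`), A2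
(`Amp.balancedTrim_holds`), A3 (`Amp.mixtureExpansion_holds`), A4 (`Amp.hybridStep`, the corrected statement with
`0 ≤ η`), A5 (`Amp.finalHybridBound_holds`), A6 (`Amp.pushforward_holds`) and the budget lemma `budget_le` are
already generic and are used BY NAME; A0 (block restriction) and A3' (curry bridge) are re-proved here for an
abstract `W` (`blockRestriction_gen`, `curryBridge_gen`, same proofs), and the assembly core `core_bound_gen` is
`Amp.core_bound` (p484409) with `3^d ↦ |W|`, `recMaj3 d ↦ Φ`.  The `+1` in the size hypothesis removes the
gate-free corner; the empty block set is a separate two-line corner (`expAbsBiasGen Φ p = 1` there).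

References: R. Impagliazzo, FOCS 1995; R. O'Donnell, JCSS 69 (2004) §3–4; A. Healy, S. Vadhan, E. Viola,
SICOMP 35 (2006) §3.

HONEST FRAMING: a KNOWN theorem (hardness amplification) ported to monotone circuits and finite weighted sums,
re-assembled for an abstract combiner; ONE registered stub of an OPEN line; FRONTIER rung F-N1 — nothing here
bears on P vs NP.
-/

set_option linter.dupNamespace false -- `Summit.PneNP.PneNP.…`: summit = sub-problem name (D-0017 single-conjunct layout)

namespace Summit.PneNP.PneNP.Theorems.NegLimitedHalfWindow

open Finset Function
open Literature.Computability.Complexity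
open Summit.PneNP.PneNP.Theorems.NegLimitedDoor (massAt agreeAt massAt_false_add_massAt_true)
open Summit.PneNP.PneNP.Theorems.NegLimitedAmplifiedWindow (budget_le)
open Summit.PneNP.PneNP.Theorems.NegLimitedAmplifiedWindow.Amp
  (bw cbias hybAgree sum_ite_agree_eq massAt_mul_one_sub prod_ite_mem_eq_pow hybridStep finalHybridBound_holds
    pushforward_holds mixtureExpansion_holds hardCoreMonotone_holds balancedTrim_holds)
open Summit.PneNP.PneNP.Theorems.CliqueExtLowerBound.Negative (MonoBasis MonoBasis.monotoneBasis01 cktSize_const01)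

/-! ### A0 and A3' for an abstract block set -/

/-- (A0, generic `W`) BLOCK RESTRICTION: fixing every block except `w` of a `{∧,∨,0,1}`-circuit on `W × ι` to
the constants `X` yields a `{∧,∨,0,1}`-circuit on `ι` with at most two more gates (proof of
`Amp.blockRestriction_holds` verbatim). -/
theorem blockRestriction_gen {ι W : Type} [Fintype ι] [DecidableEq ι] [Fintype W] [DecidableEq W]
    (M : Circuit (W × ι)) (hM : M.IsOver monotoneBasis01) (w : W) (X : W → ι → Bool) :
    ∃ C : Circuit ι, C.IsOver monotoneBasis01 ∧ C.size ≤ M.size + 2 ∧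
      ∀ y : ι → Bool, C.eval y = M.eval (fun q => update X w y q.1 q.2) := by
  classical
  have hin : CktSize monotoneBasis01 (fun (y : ι → Bool) (q : W × ι) => update X w y q.1 q.2) 2 := by
    have h := ((CktSize.id (ι := ι) monotoneBasis01).pair
      ((cktSize_const01 (ι := ι) MonoBasis.monotoneBasis01 true).pair
        (cktSize_const01 (ι := ι) MonoBasis.monotoneBasis01 false))).outMap
      (fun q : W × ι => if q.1 = w then (Sum.inl q.2 : ι ⊕ (Unit ⊕ Unit))
        else if X q.1 q.2 then Sum.inr (Sum.inl ()) else Sum.inr (Sum.inr ()))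
    refine h.congr fun y q => ?_
    obtain ⟨u, i⟩ := q
    by_cases hu : u = w
    · subst hu; simp
    · simp only [hu, if_false, update_of_ne hu]
      cases X u i <;> simp
  obtain ⟨C, hC, hs, he⟩ := (hin.comp (M.cktSize_eval hM)).toCircuit
  exact ⟨C, hC, by omega, fun y => he y⟩

/-- (A3', generic `W`, `Φ`) CURRY BRIDGE (`Equiv.curry`). -/
theorem curryBridge_gen {ι W : Type} [Fintype ι] [DecidableEq ι] [Fintype W] [DecidableEq W]
    (D : (ι → Bool) → ℝ) (f : (ι → Bool) → Bool) (Φ : (W → Bool) → Bool) (g : (W × ι → Bool) → Bool) :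
    agreeAt (fun x : W × ι → Bool => bw (fun _ : W => D) (fun w i => x (w, i)))
        (fun x => Φ fun w => f (fun i => x (w, i))) g =
      agreeAt (bw fun _ : W => D) (fun X => Φ fun w => f (X w)) (fun X => g fun q => X q.1 q.2) := by
  unfold agreeAt
  exact Fintype.sum_equiv (Equiv.curry W ι Bool) _ _ fun x => rfl

/-! ### The assembly core for an abstract combiner -/

/-- **Assembly core, generic** (`Amp.core_bound` with `3^d ↦ |W|`, `RM3_d ↦ Φ`): from a balanced trimmed
hard-core piece `D·H'` (mass `p/2` on each side of `f`, signed advantage `≤ 4γp` for every `{∧,∨,0,1}`-circuit of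
size `≤ |M|+2`) to `agreeAt ≤ ½ + ½·expAbsBiasGen Φ p + 2γ·|W|`. -/
theorem core_bound_gen {ι W : Type} [Fintype ι] [DecidableEq ι] [Fintype W] [DecidableEq W]
    (D H' : (ι → Bool) → ℝ) (f : (ι → Bool) → Bool) {Φ : (W → Bool) → Bool} (hΦ : Monotone Φ)
    (M : Circuit (W × ι)) (hM : M.IsOver monotoneBasis01) {p γ : ℝ}
    (hD : ∀ x, 0 ≤ D x) (hD1 : ∑ x, D x = 1) (hbal : massAt D f true = 1 / 2)
    (hH0 : ∀ x, 0 ≤ H' x) (hH1 : ∀ x, H' x ≤ 1) (hγ : 0 ≤ γ) (hp1 : p ≤ 1)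
    (hmt : massAt (fun x => D x * H' x) f true = p / 2) (hmf : massAt (fun x => D x * H' x) f false = p / 2)
    (hadv : ∀ C : Circuit ι, C.IsOver monotoneBasis01 → C.size ≤ M.size + 2 →
      ∑ x, D x * H' x * (if C.eval x = f x then (1 : ℝ) else -1) ≤ 4 * γ * p) :
    agreeAt (fun x : W × ι → Bool => bw (fun _ : W => D) (fun w i => x (w, i)))
        (fun x => Φ fun w => f (fun i => x (w, i))) M.eval
      ≤ 1 / 2 + (1 / 2) * expAbsBiasGen Φ p + 2 * γ * (Fintype.card W : ℝ) := by
  classical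
  set N : ℕ := Fintype.card W with hN
  set μ₁ : (ι → Bool) → ℝ := fun a => D a * H' a with hμ₁
  set μ₂ : (ι → Bool) → ℝ := fun a => D a * (1 - H' a) with hμ₂
  set g : (W → ι → Bool) → Bool := fun X => M.eval fun q => X q.1 q.2 with hg
  have hμ₁0 : ∀ a, 0 ≤ μ₁ a := fun a => mul_nonneg (hD a) (hH0 a)
  have hμ₂0 : ∀ a, 0 ≤ μ₂ a := fun a => mul_nonneg (hD a) (by linarith [hH1 a])
  -- masses
  have hbalf : massAt D f false = 1 / 2 := by
    have := massAt_false_add_massAt_true D f; rw [hbal, hD1] at this; linarith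
  have hm₁ : ∑ a, μ₁ a = p := by
    have := massAt_false_add_massAt_true μ₁ f; rw [hmt, hmf] at this; linarith
  have hp0 : 0 ≤ p := by rw [← hm₁]; exact Finset.sum_nonneg fun a _ => hμ₁0 a
  have hm₂ : ∑ a, μ₂ a = 1 - p := by
    have : ∑ a, μ₂ a = ∑ a, D a - ∑ a, μ₁ a := by
      rw [← Finset.sum_sub_distrib]; exact Finset.sum_congr rfl fun a _ => by simp only [hμ₁, hμ₂]; ring
    rw [this, hD1, hm₁]
  have hmass₁ : ∀ b, massAt μ₁ f b = p / 2 := fun b => by cases b <;> assumption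
  have hmass₂ : ∀ b, massAt μ₂ f b = (1 - p) / 2 := fun b => by
    rw [hμ₂, massAt_mul_one_sub]
    cases b
    · rw [hbalf, hmf]; ring
    · rw [hbal, hmt]; ring
  -- A3' + A3
  rw [curryBridge_gen D f Φ M.eval]
  have hDμ : (fun _ : W => D) = fun _ => μ₁ + μ₂ := by
    funext w; funext a; simp only [Pi.add_apply, hμ₁, hμ₂]; ring
  rw [hDμ, mixtureExpansion_holds W (ι → Bool) μ₁ μ₂]
  -- the weight with hard set `S`
  set μS : Finset W → W → (ι → Bool) → ℝ := fun S w => if w ∈ S then μ₁ else μ₂ with hμS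
  have hμS0 : ∀ S w a, 0 ≤ μS S w a := fun S w a => by
    simp only [hμS]; split_ifs; exacts [hμ₁0 a, hμ₂0 a]
  have hsumS : ∀ S w, ∑ a, μS S w a = if w ∈ S then p else 1 - p := fun S w => by
    simp only [hμS]; split_ifs; exacts [hm₁, hm₂]
  have hmassS : ∀ S w b, massAt (μS S w) f b = if w ∈ S then p / 2 else (1 - p) / 2 := fun S w b => by
    simp only [hμS]; split_ifs; exacts [hmass₁ b, hmass₂ b]
  have hPi : ∀ S : Finset W, ∏ w, ∑ a, μS S w a = p ^ S.card * (1 - p) ^ (N - S.card) :=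
    fun S => by rw [Finset.prod_congr rfl fun w _ => hsumS S w, prod_ite_mem_eq_pow]
  -- per-`S` bound
  have hper : ∀ S : Finset W,
      agreeAt (bw (μS S)) (fun X => Φ fun w => f (X w)) g ≤
        (1 / 2) * (p ^ S.card * (1 - p) ^ (N - S.card)) +
        (1 / 2) * ((p / 2) ^ S.card * ((1 - p) / 2) ^ (N - S.card) * ∑ v : W → Bool, |cbias Φ S v|) +
        2 * γ * S.card * (p ^ S.card * (1 - p) ^ (N - S.card)) := by
    intro S
    -- A4 with `η = 2γ`: the one-block hypothesis from A0 + `hadv`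
    have hyp : ∀ w ∈ S, ∀ X : W → ι → Bool,
        (∑ a, if g (update X w a) = f a then μS S w a else 0) ≤ (1 / 2 + 2 * γ) * ∑ a, μS S w a := by
      intro w hw X
      have hμw : μS S w = μ₁ := by simp only [hμS, hw, if_true]
      rw [hμw, hm₁]
      obtain ⟨C, hC, hCs, hCe⟩ := blockRestriction_gen M hM w X
      have hgC : ∀ a, g (update X w a) = C.eval a := fun a => by rw [hCe a]
      simp only [hgC]
      rw [sum_ite_agree_eq, hm₁]
      have := hadv C hC hCs
      linarith
    have h4 := hybridStep (μS S) f hΦ g S (by positivity : (0 : ℝ) ≤ 2 * γ) (hμS0 S) hyp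
    -- A5
    have h5 := finalHybridBound_holds W (ι → Bool) (μS S) f Φ g S (hμS0 S)
    -- A6
    have h6 := pushforward_holds W (ι → Bool) (μS S) f (fun v => |cbias Φ S v|)
    have h6' : ∑ v : W → Bool, (∏ w, massAt (μS S w) f (v w)) * |cbias Φ S v| =
        (p / 2) ^ S.card * ((1 - p) / 2) ^ (N - S.card) * ∑ v : W → Bool, |cbias Φ S v| := by
      rw [Finset.mul_sum]
      refine Finset.sum_congr rfl fun v _ => ?_
      rw [Finset.prod_congr rfl fun w _ => hmassS S w (v w), prod_ite_mem_eq_pow]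
    rw [hPi S] at h4 h5
    rw [h6, h6'] at h5
    linarith
  refine (Finset.sum_le_sum fun S _ => hper S).trans ?_
  rw [Finset.sum_add_distrib, Finset.sum_add_distrib, ← Finset.mul_sum, ← Finset.mul_sum]
  -- binomial resummations
  have hbin : ∑ S : Finset W, p ^ S.card * (1 - p) ^ (N - S.card) = 1 := by
    rw [hN, Fintype.sum_pow_mul_eq_add_pow]; ring_nf
  have hE : ∑ S : Finset W, (p / 2) ^ S.card * ((1 - p) / 2) ^ (N - S.card) *
      ∑ v : W → Bool, |cbias Φ S v| = expAbsBiasGen Φ p := by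
    unfold expAbsBiasGen
    refine Finset.sum_congr rfl fun S _ => ?_
    rw [Finset.mul_sum]
  have hlin : ∑ S : Finset W, 2 * γ * S.card * (p ^ S.card * (1 - p) ^ (N - S.card)) ≤
      2 * γ * (N : ℝ) := by
    calc ∑ S : Finset W, 2 * γ * S.card * (p ^ S.card * (1 - p) ^ (N - S.card))
        ≤ ∑ S : Finset W, 2 * γ * (N : ℝ) * (p ^ S.card * (1 - p) ^ (N - S.card)) := by
          refine Finset.sum_le_sum fun S _ => ?_
          have hS : (S.card : ℝ) ≤ (N : ℝ) := by
            have := S.card_le_univ; rw [hN]; exact_mod_cast this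
          have hw : 0 ≤ p ^ S.card * (1 - p) ^ (N - S.card) :=
            mul_nonneg (pow_nonneg hp0 _) (pow_nonneg (by linarith) _)
          exact mul_le_mul_of_nonneg_right (mul_le_mul_of_nonneg_left hS (by positivity)) hw
      _ = 2 * γ * (N : ℝ) := by rw [← Finset.mul_sum, hbin, mul_one]
  rw [hbin, hE]
  linarith

/-! ### The empty block set -/

/-- With no blocks the expected absolute bias is `1` (the combiner is a constant). -/
theorem expAbsBiasGen_of_isEmpty {W : Type} [Fintype W] [DecidableEq W] [IsEmpty W]
    (Φ : (W → Bool) → Bool) (p : ℝ) : expAbsBiasGen Φ p = 1 := by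
  classical
  unfold expAbsBiasGen
  have hcard : Fintype.card W = 0 := Fintype.card_eq_zero
  have hS : ∀ S : Finset W, S = ∅ := fun S => Finset.eq_empty_of_isEmpty S
  rw [Fintype.sum_eq_single (∅ : Finset W) fun S hne => (hne (hS S)).elim]
  haveI : Unique (W → Bool) := Pi.uniqueOfIsEmpty _
  rw [Fintype.sum_unique]
  simp only [Finset.card_empty, pow_zero, hcard, Nat.sub_zero, one_mul]
  unfold cbias
  rw [hcard, Fintype.sum_unique]
  simp only [pow_zero, inv_one, one_mul]
  unfold Summit.PneNP.PneNP.Theorems.NegLimitedAmplifiedWindow.Amp.sgn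
  split_ifs <;> simp

/-! ### The stub -/

/-- **Registered stub `stub_monotoneAmplificationGen`** of the skeleton `half-window` (stmt-PneNP-19888):
generic monotone hardness amplification `MonotoneAmplificationGen`, with `e = 8` and `K = 5184/β⁴ + 1`. -/
theorem stub_monotoneAmplificationGen : MonotoneAmplificationGen := by
  classical
  refine ⟨8, fun β hβ => ?_⟩
  obtain ⟨K, hK⟩ : ∃ K : ℝ, K = 5184 / β ^ 4 + 1 := ⟨_, rfl⟩
  have hK1 : 1 ≤ K := by rw [hK]; linarith [show (0 : ℝ) ≤ 5184 / β ^ 4 by positivity]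
  have hK5184 : 5184 / β ^ 4 ≤ K := by rw [hK]; linarith
  refine ⟨K, by linarith, ?_⟩
  intro ι W _ _ _ _ D f Φ s hD hD1 _hf hbal hΦ hhard M hM hsize
  -- total mass of the block-product weight is `1`, so agreement is at most `1`
  have hagree_le_one : agreeAt (fun x : W × ι → Bool => bw (fun _ : W => D) (fun w i => x (w, i)))
      (fun x => Φ fun w => f (fun i => x (w, i))) M.eval ≤ 1 := by
    rw [curryBridge_gen D f Φ M.eval]
    unfold agreeAt
    have hbw0 : ∀ X : W → ι → Bool, 0 ≤ bw (fun _ : W => D) X :=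
      fun X => Summit.PneNP.PneNP.Theorems.NegLimitedAmplifiedWindow.Amp.bw_nonneg (fun _ a => hD a) X
    calc (∑ X : W → ι → Bool, if (M.eval fun q => X q.1 q.2) = Φ (fun w => f (X w))
            then bw (fun _ : W => D) X else 0)
        ≤ ∑ X : W → ι → Bool, bw (fun _ : W => D) X :=
          Finset.sum_le_sum fun X _ => by split_ifs <;> simp [hbw0 X]
      _ = 1 := by
          rw [Summit.PneNP.PneNP.Theorems.NegLimitedAmplifiedWindow.Amp.sum_bw_eq_prod]
          simp [hD1]
  rcases isEmpty_or_nonempty W with hW | hW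
  · -- no blocks: `Φ` is constant, `expAbsBiasGen Φ (β/2) = 1`
    rw [expAbsBiasGen_of_isEmpty Φ (β / 2)]
    have : (0 : ℝ) ≤ (Fintype.card W : ℝ)⁻¹ := by positivity
    linarith
  -- `W` nonempty: `N = |W| ≥ 1`
  obtain ⟨N, hN⟩ : ∃ N : ℝ, N = (Fintype.card W : ℝ) := ⟨_, rfl⟩
  rw [← hN] at hsize ⊢
  have hN1 : 1 ≤ N := by rw [hN]; exact_mod_cast Fintype.card_pos
  have hN0 : 0 < N := by linarith
  -- `1 ≤ s`
  have hs1 : 1 ≤ s := by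
    have h1 : (1 : ℝ) ≤ (M.size : ℝ) + 1 := by
      have : (0 : ℝ) ≤ M.size := by positivity
      linarith
    have : (1 : ℝ) ≤ s :=
      (one_le_mul_of_one_le_of_one_le (one_le_mul_of_one_le_of_one_le h1 hK1) (one_le_pow₀ hN1)).trans hsize
    exact_mod_cast this
  -- `β ≤ ½` from the constant circuit
  have hβhalf : β ≤ 1 / 2 := by
    obtain ⟨C, hC, hCs, hCe⟩ := (cktSize_const01 (ι := ι) MonoBasis.monotoneBasis01 true).toCircuit
    have h := hhard C hC (hCs.trans hs1)
    have : agreeAt D f C.eval = massAt D f true := by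
      unfold agreeAt massAt
      exact Finset.sum_congr rfl fun x _ => by rw [hCe x]; simp only [eq_comm]
    rw [this, hbal] at h
    linarith
  -- parameters
  obtain ⟨p, hp⟩ : ∃ p : ℝ, p = β / 2 := ⟨_, rfl⟩
  have hp0 : 0 < p := by rw [hp]; positivity
  have hp1 : p ≤ 1 := by rw [hp]; linarith
  obtain ⟨γ, hγ⟩ : ∃ γ : ℝ, γ = 1 / (2 * N ^ 2) := ⟨_, rfl⟩
  have hγ0 : 0 < γ := by rw [hγ]; positivity
  have hγhalf : γ ≤ 1 / 2 := by
    rw [hγ, div_le_div_iff₀ (by positivity) (by norm_num)]; nlinarith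
  have hγβ : 0 < γ * β := mul_pos hγ0 hβ
  have hγβ1 : γ * β ≤ 1 := by nlinarith
  -- A1: hard-core measure for size-`(|M|+2)` monotone circuits
  have hsize' : (((M.size + 1 : ℕ) : ℝ)) * K * N ^ 8 ≤ s := by push_cast; exact hsize
  have hbudget : ∀ t : ℕ, (t : ℝ) ≤ 4 / (γ * β) ^ 2 + 2 / (γ * β) →
      t * (M.size + 2) + (t / 2 + 1) * (2 * t + 1) ≤ s := by
    intro t ht
    have hb := budget_le (N := N) (m := M.size + 1) hβ hN1 (by omega) hK1 hK5184 hsize' (ht.trans ?_)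
    · have : t * (M.size + 2) ≤ t * (M.size + 1 + 2) := Nat.mul_le_mul_left _ (by omega)
      omega
    -- `4/(γβ)² + 2/(γβ) ≤ 6/(γβ)² = 24 N⁴/β²`
    have h1 : 2 / (γ * β) ≤ 2 / (γ * β) ^ 2 := by
      rw [div_le_div_iff₀ hγβ (by positivity)]
      nlinarith
    have h2 : 6 / (γ * β) ^ 2 = 24 * N ^ 4 / β ^ 2 := by rw [hγ]; field_simp; ring
    have h3 : 4 / (γ * β) ^ 2 + 2 / (γ * β) ^ 2 = 6 / (γ * β) ^ 2 := by ring
    linarith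
  obtain ⟨H, hH0, hH1, hHβ, hHadv⟩ :=
    hardCoreMonotone_holds ι D f s (M.size + 2) β γ hD hD1 hβ hγ0 hhard hbudget
  -- A2: balanced trim on the class of size-`(|M|+2)` monotone circuits
  obtain ⟨𝒢, h𝒢⟩ : ∃ 𝒢 : Set ((ι → Bool) → Bool),
      𝒢 = {g | ∃ C : Circuit ι, C.IsOver monotoneBasis01 ∧ C.size ≤ M.size + 2 ∧ C.eval = g} := ⟨_, rfl⟩
  have hconst : ∀ b : Bool, (fun _ : ι → Bool => b) ∈ 𝒢 := fun b => by
    obtain ⟨C, hC, hCs, hCe⟩ := (cktSize_const01 (ι := ι) MonoBasis.monotoneBasis01 b).toCircuit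
    rw [h𝒢]; exact ⟨C, hC, by omega, funext hCe⟩
  have h𝒢adv : ∀ g ∈ 𝒢, ∑ x, D x * H x * (if g x = f x then (1 : ℝ) else -1) < γ * ∑ x, D x * H x := by
    intro g hg; rw [h𝒢] at hg; obtain ⟨C, hC, hCs, rfl⟩ := hg; exact hHadv C hC hCs
  obtain ⟨H', hH'0, hH'1, hmt, hmf, hadv⟩ := balancedTrim_holds (ι → Bool) D H f 𝒢 β γ p hD hH0 hH1 hγ0
    hγhalf hp0 (by rw [hp]; nlinarith) hHβ (hconst true) (hconst false) h𝒢adv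
  -- the core bound
  have hcore := core_bound_gen D H' f hΦ M hM hD hD1 hbal hH'0 hH'1 hγ0.le hp1 hmt hmf
    (fun C hC hCs => hadv C.eval (by rw [h𝒢]; exact ⟨C, hC, hCs, rfl⟩))
  rw [← hN] at hcore
  -- numerics: `2γN = 1/N`
  have hγN : 2 * γ * N = N⁻¹ := by rw [hγ]; field_simp
  rw [hp] at hcore
  rw [← hγN]
  linarith
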